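import Summits.QuantumFields.BalabanUV.Beta.GAN24.TaylorLamBracket
import Summits.QuantumFields.BalabanUV.Beta.GAN24.E3UnitSplitLevelsSymAt

/-!
# The TOP Λ row's vertex insertion AT THE SYM TABLE: `vertex_symLagrIncAt_top` (sym twin of leaf-04 g55's (ρ-d) `TaylorLamBracketAt`, itself the rooted twin of `TaylorLamBracket`)

NOT IN PRINT — OUR BOOKKEEPING (road-P2 = `b2b-balaban-gan24-p2` gen 56, 2026-08-25; row G-an2-4 ∕ (CONV-C), the (α-0) chain at row D1's literal
OF RECORD (III′) `JsB12CombShSym`; [folklore] composition BY NAME; 0 `def`, 0 cite, 0 `def … : Prop`, 0 `sorry`).  Weight 0.  NEVER «G-an2-4 closed» as (CONV-C);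
NOT D1, NOT BetaPertH, NOT continuum, NOT Clay; NO campaign opened (an2 W-4) — typed while idle under R-2 as a brick of the located `hUg-Λ` transfer
(road-P2 MEMO M-gan24p2-g56-1, `gen56/S-CAMPAIGN-SIZING-g56.v0_4.md` §2(a)).

METHOD = the OWNER gan24-p1's gen-6 `mkroot.py` rule (road-P2's `tools/mksym.py`): the ROOTED file VERBATIM with an1's SYM table `symHessFFAt (toSite r) Lc` (`r ∈ box (d+1) Lc`)
in place of the rooted `hessFFAt (toSite r) Lc` and the symmetrised increment `E3UnitSplitLevelsSymAt.symLagrIncAt` (M.66) in place of asym's `SpineRooted.lagrIncAt`; an1's sym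
support ∕ entry ∕ `biLoc` lemmas (`symHessKerAt_eq_zero_left ∕ _right`, `abs_symHessKerAt_le ≤ 2ℓ²`, `symHessFFAt_inl_*`, `biLoc_symHessFFAt` — SAME constants as the rooted ones) and
(ρ-a)-sym `TaylorMassLamSymAt` (M.65) where the rooted file reads an1's rooted lemmas ∕ (ρ-a); every ROOT-FREE lemma of the base modules BY NAME (not re-declared); same theorem
names in the `…SymAt` namespace; base and rooted modules untouched; no zero-root bridge (the sym table has no root-0 base twin).
Discharges NOTHING of (hS, hSall), the K-slot or BetaPertH by itself.
## Contents
`abs_avgLift_symHessFFAt_le` (entrywise `≤ 2ℓ²`, from an1's `abs_symHessKerAt_le`), **`vertex_symLagrIncAt_top`** (the base's root-free `vertex_SLam_top` at the lifted sym table).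
-/

noncomputable section

open Finset
open scoped BigOperators
open Literature.MathematicalPhysics.QuantumFieldTheory
open Literature.MathematicalPhysics.QuantumFieldTheory.Balaban1983to89
open Literature.MathematicalPhysics.QuantumFieldTheory.Balaban1983to89.Beta
open AffineAveraging (Site box toSite)
open OneStepResolventKernel (Fib KInv)
open KernelSpecInstance (wH wΦ)
open BalabanStepJets (lamCoeffOf)
open InterLevelTransport (SLam avgLift)
open BalabanCompositeJets (lagrInc)
open AveragingHessianKernels (hessFF ell)
open Summit.QuantumFields.BalabanUV.Beta.SymAveragingHessianCounts (symHessFFAt symHessKerAt symHessFFAt_inl_inl symHessFFAt_inl_inr symHessFFAt_inr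
  symHessKerAt_eq_zero_left symHessKerAt_eq_zero_right abs_symHessKerAt_le biLoc_symHessFFAt)
open DecLiftAdjoint (abs_avgLift_le)
open Summit.QuantumFields.BalabanUV.Beta.GAN24.E3UnitSplitLevelsSymAt (symLagrIncAt)
open Summit.QuantumFields.BalabanUV.Beta.GAN24.TaylorLamBracket (vertex_SLam_top vertex_lagrInc_top)

namespace Summit.QuantumFields.BalabanUV.Beta.GAN24.TaylorLamBracketSymAt

variable {d : ℕ} {N : ℕ} [NeZero N]

/-- [folklore] an1's ROOTED one-step constraint Hessians (box root), lifted to the fine field legs, are entrywise bounded by `2·ℓ(Lc)²` (uniformly in the coarse bond,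
the blocking `M`, the root offset in the box and the arguments): `biLoc_symHessFFAt` at rate `0` and `DecLiftAdjoint.abs_avgLift_le`. -/
theorem abs_avgLift_symHessFFAt_le {Lc : ℕ} (M : ℕ) [NeZero M] (hLc : 1 ≤ Lc) {r : Fin (d + 1) → ℕ} (hr : r ∈ box (d + 1) Lc)
    (μ : Fin (d + 1)) (yy w y : Site (d + 1)) (a b : Fib d) :
    |avgLift M (symHessFFAt (toSite r) (d := d) Lc μ yy) w y a b| ≤ 2 * (ell (d + 1) Lc : ℝ) ^ 2 := by
  refine abs_avgLift_le M (fun x w' a' b' => ?_) w y a b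
  simpa using biLoc_symHessFFAt (d := d) hLc μ yy hr le_rfl x w' a' b'

/-- [folklore] **TOP Λ ROW, ROOTED: THE VERTEX INSERTION OF THE ROOTED LAGRANGE INCREMENT** (box root; every `M`, `N ≥ 1`, `Lc ≥ 1`) —
`Σ_{κ″} Σ'_u wH_N κ″ κ′ (u − N•u′) · symLagrIncAt d (toSite r) Lc M N κ″ u w y a b = Σ_μ Σ'_yy wΦ_N κ′ μ (u′ − yy) · avgLift M (symHessFFAt (toSite r) Lc μ yy) w y a b`
(the base `vertex_SLam_top` with the rooted, entrywise-bounded `Q2`). -/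
theorem vertex_symLagrIncAt_top {Lc : ℕ} (M : ℕ) [NeZero M] (hLc : 1 ≤ Lc) {r : Fin (d + 1) → ℕ} (hr : r ∈ box (d + 1) Lc)
    (κ' : Fin (d + 1)) (u' w y : Site (d + 1)) (a b : Fib d) :
    ∑ κ'', ∑' u, wH (N := N) κ'' κ' (u - (N : ℤ) • u') * symLagrIncAt d (toSite r) Lc M N κ'' u w y a b =
      ∑ μ, ∑' yy, wΦ (N := N) κ' μ (u' - yy) * avgLift M (symHessFFAt (toSite r) (d := d) Lc μ yy) w y a b :=
  vertex_SLam_top (N := N) (fun μ yy => avgLift M (symHessFFAt (toSite r) (d := d) Lc μ yy))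
    (fun μ yy w y a b => abs_avgLift_symHessFFAt_le M hLc hr μ yy w y a b) κ' u' w y a b


end Summit.QuantumFields.BalabanUV.Beta.GAN24.TaylorLamBracketSymAt

end
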